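import Summits.Ventures.Crystal3D.StickySpheres.ConeGraph
import Mathlib.Data.Finset.Max
import Mathlib.Tactic.IntervalCases
import HarnessLib

/-!
# The extension step (Lemma R6) as a certificate rule: complete lists one vertex up

Venture `Crystal3D` (cell `pub-crystal3d`, seat p3). `GraphStratum.lean` (seat p2) made the census statement a
statement about graphs (`GraphStratumHypothesis d e n`: no graph on `n` vertices with `e` edges and minimum degree
`≥ d` is relaxed-realisable) and proved the soundness of the DELETION-LOOKUP decider. This file formalises the other
half of the cell's `T(12)` / `T(13)` certificates (PLAN R30–R32, `paper/REDUCTIONS.md` Addenda 3–4 = Lemma R6 and the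
degree-sliced identities of R31): the ONE-VERTEX EXTENSION step.

* `CompleteListHypothesis d e n L` — every relaxed-realisable graph on `Fin n` with exactly `e` edges and minimum
  degree `≥ d` is isomorphic to a member of the set `L` ("`L ⊇ S_n(e)^{δ ≥ d}` up to isomorphism"; the members of
  `L` need NOT be realisable — undecided graphs may be carried, exactly as in R29.1). `L = ∅` is `GraphStratumHypothesis`
  (`completeListHypothesis_empty_iff`).
* `RelaxedRealisable.card_edgeFinset_le_maxContacts` (a relaxed-realisable graph has at most `C(n)` edges),
  `completeListHypothesis_of_maxContacts_lt` (strata above `C(n)` are empty) and the DEGREE FLOOR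
  `CompleteListHypothesis.of_degree_floor` (fact (F1) of Addendum 3: if `C(n) ≤ c` and `d + c ≤ e`, a list complete for
  minimum degree `≥ d` is complete outright).
* **`completeList_succ_of_coneExtensions`** (Lemma R6 as a rule). Let `2e < (D + 1)(n + 1)`. Suppose that for every
  `d ≤ d' ≤ D` a complete list `L d'` for the stratum `(d' − 1, e − d', n)` is given, and that every cone
  `coneGraph (Fin.last n) H S` over a listed `H ∈ L d'` with `|S| = d'` whose minimum degree is `≥ d'` (referee's rule
  (ii): the new vertex must be a minimum-degree vertex; other cones are DISCARDED) is either not relaxed-realisable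
  or isomorphic to a member of `M`. Then `M` is a complete list for the stratum `(d, e, n + 1)`. Proof: a minimum-degree
  vertex `v` of a relaxed-realisable `G` has degree `d' ∈ [d, D]`; `G − v` is relaxed-realisable with `e − d'` edges and
  minimum degree `≥ d' − 1` (`ConeGraph.lean`), hence isomorphic to some listed `H`, and `G ≅ coneGraph _ H S`
  (`isoConeGraph`). With `M = ∅` this is `graphStratumHypothesis_succ_of_coneExtensions`.
* `CompleteListHypothesis.not_relaxedRealisable_of_absent` / `not_relaxedRealisable_of_deleteVertex_absent` — the
  deletion-lookup refutation in list form, and `isEmpty_iso_of_degrees_ne` (absence by degree multiset).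
* Instances in the shape the cell uses: `graphStratum_twelve_of_coneExtensions`
  (`GSH(5, 34, 12) ⇐` a complete list for `(4, 29, 11)` + the `⊕5` cone check, R30) and
  `graphStratum_thirteen_of_coneExtensions` (`GSH(4, 37, 13) ⇐` complete lists for `(3, 33, 12)` and `(4, 32, 12)` + the
  `⊕4` / `⊕5` cone checks, R31/R32), and `maxContacts_three_thirteen_of_coneExtensions` (`C(13) = 36` from these and
  the rows `n = 8, …, 12`).

HONEST FRAMING: elementary combinatorics, [folklore]. Every complete list remains a HYPOTHESIS (discharged, if ever, by
the cell's certified enumeration); this file only fixes WHAT such a certificate must establish and proves that it then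
implies the graph stratum statements. Nothing about crystallization is claimed.
-/

namespace Summit.Ventures.Crystal3D

open Finset SimpleGraph

variable {n : ℕ}

/-! ### 1. Relaxed realisability: isomorphism invariance and the edge bound -/

/-- Relaxed realisability is invariant under graph isomorphism (relabel the configuration). [folklore] -/
theorem RelaxedRealisable.of_iso {m n : ℕ} {G : SimpleGraph (Fin m)} {H : SimpleGraph (Fin n)} (φ : G ≃g H)
    (hG : RelaxedRealisable G) : RelaxedRealisable H :=
  RelaxedRealisable.of_le_comap (G := G) (H := H) φ.symm φ.symm.injective
    (fun _ _ hij => (φ.symm.map_adj_iff).2 hij) hG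

/-- **A relaxed-realisable graph on `n` vertices has at most `C(n)` edges**: its realising configuration is a unit
packing whose contact pairs contain the edges. [folklore] -/
theorem RelaxedRealisable.card_edgeFinset_le_maxContacts {G : SimpleGraph (Fin n)} [DecidableRel G.Adj]
    (hG : RelaxedRealisable G) : G.edgeFinset.card ≤ maxContacts 3 n := by
  obtain ⟨x, hxe, hxs⟩ := hG
  have hx : IsUnitPacking x := fun i j hij => hxs i j hij
  have hdeg : ∀ i, G.degree i ≤ coordination x i := by
    intro i
    rw [← card_neighborFinset_eq_degree]
    refine Finset.card_le_card fun j hj => ?_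
    rw [mem_neighborFinset] at hj
    rw [mem_contactNeighbors]
    exact ⟨(G.ne_of_adj hj).symm, hxe i j hj⟩
  have h1 := G.sum_degrees_eq_twice_card_edges
  have h2 := sum_coordination_eq x
  have h3 : ∑ i, G.degree i ≤ ∑ i, coordination x i := Finset.sum_le_sum fun i _ => hdeg i
  have h4 := numContacts_le_maxContacts hx
  omega

/-! ### 2. Complete lists -/

/-- **Complete-list hypothesis** `CL(d, e, n; L)`: every relaxed-realisable graph on `Fin n` with exactly `e` edges and
all degrees `≥ d` is isomorphic to some member of `L`. (What a certified sweep "every non-refuted graph of the stratum is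
listed" establishes; members of `L` need not be realisable.) A hypothesis schema; never asserted here. [folklore] -/
def CompleteListHypothesis (d e n : ℕ) (L : Set (SimpleGraph (Fin n))) : Prop :=
  ∀ G : SimpleGraph (Fin n), ∀ [DecidableRel G.Adj],
    G.edgeFinset.card = e → (∀ i, d ≤ G.degree i) → RelaxedRealisable G → ∃ H ∈ L, Nonempty (G ≃g H)

/-- The empty list is complete iff the graph stratum is empty: `CL(d, e, n; ∅) ↔ GSH(d, e, n)`. [folklore] -/
theorem completeListHypothesis_empty_iff {d e n : ℕ} :
    CompleteListHypothesis d e n ∅ ↔ GraphStratumHypothesis d e n := by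
  constructor
  · intro h G _ he hd hG
    obtain ⟨H, hH, -⟩ := h G he hd hG
    exact hH
  · intro h G _ he hd hG
    exact (h G he hd hG).elim

/-- A bigger list is still complete. [folklore] -/
theorem CompleteListHypothesis.mono {d e n : ℕ} {L M : Set (SimpleGraph (Fin n))} (hLM : L ⊆ M)
    (hL : CompleteListHypothesis d e n L) : CompleteListHypothesis d e n M := by
  intro G _ he hd hG
  obtain ⟨H, hH, hiso⟩ := hL G he hd hG
  exact ⟨H, hLM hH, hiso⟩

/-- Raising the degree floor weakens the hypothesis. [folklore] -/
theorem CompleteListHypothesis.of_le {d d' e n : ℕ} {L : Set (SimpleGraph (Fin n))} (hdd' : d ≤ d')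
    (hL : CompleteListHypothesis d e n L) : CompleteListHypothesis d' e n L :=
  fun G _ he hd hG => hL G he (fun i => hdd'.trans (hd i)) hG

/-- **Strata above the contact number are empty:** if `C(n) < e` then ANY list (in particular `∅`) is complete for
`(d, e, n)`. [folklore] -/
theorem completeListHypothesis_of_maxContacts_lt {d e n : ℕ} (h : maxContacts 3 n < e)
    (L : Set (SimpleGraph (Fin n))) : CompleteListHypothesis d e n L := by
  intro G _ he _ hG
  have := hG.card_edgeFinset_le_maxContacts
  omega

/-- **Degree floor (fact (F1)).** If `C(n) ≤ c` and `d + c ≤ e`, every relaxed-realisable graph on `n + 1` vertices with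
`e` edges has minimum degree `≥ d` automatically (delete a vertex: the rest keeps `e − deg` edges, at most `c`), so a
list complete for the floor `d` is complete for every floor `d₀`. [folklore] -/
theorem CompleteListHypothesis.of_degree_floor {n e d c : ℕ} {L : Set (SimpleGraph (Fin (n + 1)))}
    (hc : maxContacts 3 n ≤ c) (hd : d + c ≤ e) (hL : CompleteListHypothesis d e (n + 1) L) (d₀ : ℕ) :
    CompleteListHypothesis d₀ e (n + 1) L := by
  intro G _ he _ hG
  refine hL G he (fun i => ?_) hG
  have h1 := card_edgeFinset_comap_succAbove_add_degree G i
  have h2 := (hG.deleteVertex i).card_edgeFinset_le_maxContacts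
  omega

/-! ### 3. Refutation by lookup -/

/-- A graph in the stratum that is isomorphic to NO member of a complete list is not relaxed-realisable. [folklore] -/
theorem CompleteListHypothesis.not_relaxedRealisable_of_absent {d e n : ℕ} {L : Set (SimpleGraph (Fin n))}
    (hL : CompleteListHypothesis d e n L) (G : SimpleGraph (Fin n)) [DecidableRel G.Adj]
    (he : G.edgeFinset.card = e) (hd : ∀ i, d ≤ G.degree i) (habs : ∀ H ∈ L, IsEmpty (G ≃g H)) :
    ¬ RelaxedRealisable G := by
  intro hG
  obtain ⟨H, hH, ⟨φ⟩⟩ := hL G he hd hG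
  exact (habs H hH).false φ

/-- **Deletion lookup.** If deleting the vertex `w` from `G` lands in a stratum `(d, e, n)` with a complete list `L`
and `G − w` is isomorphic to no member of `L`, then `G` is not relaxed-realisable. (The cell's R32.0 decider; its
`H ≤ G.comap w.succAbove` form is `not_relaxedRealisable_of_deleteVertex` in `GraphStratum.lean`.) [folklore] -/
theorem not_relaxedRealisable_of_deleteVertex_absent {d e : ℕ} {L : Set (SimpleGraph (Fin n))}
    (hL : CompleteListHypothesis d e n L) (G : SimpleGraph (Fin (n + 1))) [DecidableRel G.Adj] (w : Fin (n + 1))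
    (he : (G.comap w.succAbove).edgeFinset.card = e) (hd : ∀ i, d ≤ (G.comap w.succAbove).degree i)
    (habs : ∀ H ∈ L, IsEmpty (G.comap w.succAbove ≃g H)) : ¬ RelaxedRealisable G :=
  not_relaxedRealisable_of_deleteVertex w le_rfl (hL.not_relaxedRealisable_of_absent _ he hd habs)

/-- **Absence by invariant:** graphs with different degree multisets are not isomorphic. [folklore] -/
theorem isEmpty_iso_of_degrees_ne {V W : Type*} [Fintype V] [Fintype W] (G : SimpleGraph V) (H : SimpleGraph W)
    [DecidableRel G.Adj] [DecidableRel H.Adj]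
    (h : (Finset.univ : Finset V).val.map (fun v => G.degree v) ≠ (Finset.univ : Finset W).val.map fun w => H.degree w) :
    IsEmpty (G ≃g H) := by
  refine ⟨fun φ => h ?_⟩
  rw [← Finset.map_univ_equiv φ.toEquiv, Finset.map_val, Multiset.map_map]
  refine Multiset.map_congr rfl fun v _ => ?_
  simp only [Function.comp_apply, Equiv.coe_toEmbedding, RelIso.coe_fn_toEquiv, Iso.degree_eq]

/-! ### 4. The extension step -/

/-- A vertex of minimum degree exists (`n + 1 ≥ 1` vertices). [folklore] -/
theorem exists_degree_le_degree (G : SimpleGraph (Fin (n + 1))) [DecidableRel G.Adj] :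
    ∃ v, ∀ i, G.degree v ≤ G.degree i := by
  obtain ⟨v, -, hv⟩ := Finset.exists_min_image Finset.univ (fun i => G.degree i) Finset.univ_nonempty
  exact ⟨v, fun i => hv i (Finset.mem_univ i)⟩

/-- The minimum degree is at most the average: if `2|E| < (D + 1)(n + 1)` then a minimum-degree vertex has degree
`≤ D`. [folklore] -/
theorem degree_le_of_twice_card_edgeFinset_lt (G : SimpleGraph (Fin (n + 1))) [DecidableRel G.Adj] {D : ℕ}
    (hD : 2 * G.edgeFinset.card < (D + 1) * (n + 1)) (v : Fin (n + 1)) (hv : ∀ i, G.degree v ≤ G.degree i) :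
    G.degree v ≤ D := by
  by_contra h
  have h1 : ∑ _i : Fin (n + 1), (D + 1) ≤ ∑ i, G.degree i :=
    Finset.sum_le_sum fun i _ => by have := hv i; omega
  rw [Finset.sum_const, Finset.card_univ, Fintype.card_fin, smul_eq_mul, G.sum_degrees_eq_twice_card_edges] at h1
  rw [Nat.mul_comm (D + 1) (n + 1)] at hD
  omega

/-- **The extension step (Lemma R6 as a certificate rule).** Let `2e < (D + 1)(n + 1)`. Suppose that for every
`d ≤ d' ≤ D` the set `L d'` is a complete list for the stratum `(d' − 1, e − d', n)`, and that every cone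
`coneGraph (Fin.last n) H S` over a listed `H ∈ L d'` with `|S| = d'` and all degrees `≥ d'` is either not
relaxed-realisable or isomorphic to a member of `M`. Then `M` is a complete list for the stratum `(d, e, n + 1)`.
[folklore] -/
theorem completeList_succ_of_coneExtensions {n e d D : ℕ} (hD : 2 * e < (D + 1) * (n + 1))
    (L : ℕ → Set (SimpleGraph (Fin n))) (M : Set (SimpleGraph (Fin (n + 1))))
    (hL : ∀ d', d ≤ d' → d' ≤ D → CompleteListHypothesis (d' - 1) (e - d') n (L d'))
    (hExt : ∀ d', d ≤ d' → d' ≤ D → ∀ H ∈ L d', ∀ [DecidableRel H.Adj], ∀ S : Finset (Fin n), S.card = d' →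
      (∀ a, d' ≤ (coneGraph (Fin.last n) H S).degree a) → RelaxedRealisable (coneGraph (Fin.last n) H S) →
      ∃ G' ∈ M, Nonempty (coneGraph (Fin.last n) H S ≃g G')) :
    CompleteListHypothesis d e (n + 1) M := by
  intro G _ he hdG hG
  -- a vertex `v` of minimum degree `d' ∈ [d, D]`
  obtain ⟨v, hv⟩ := exists_degree_le_degree G
  have hdd' : d ≤ G.degree v := hdG v
  have hd'D : G.degree v ≤ D := degree_le_of_twice_card_edgeFinset_lt G (by rw [he]; exact hD) v hv
  -- the deleted graph `G − v` lies in the stratum `(d' − 1, e − d', n)` and is relaxed-realisable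
  have hKe : (G.comap v.succAbove).edgeFinset.card = e - G.degree v := by
    rw [card_edgeFinset_comap_succAbove, he]
  have hKd : ∀ i, G.degree v - 1 ≤ (G.comap v.succAbove).degree i := fun i =>
    le_trans (Nat.sub_le_sub_right (hv (v.succAbove i)) 1) (degree_sub_one_le_degree_comap_succAbove G v i)
  obtain ⟨H, hHL, ⟨φ⟩⟩ := hL (G.degree v) hdd' hd'D (G.comap v.succAbove) hKe hKd (hG.deleteVertex v)
  -- `G` is the cone over `H`
  classical
  let ψ := isoConeGraph G v φ (Fin.last n)
  have hS : ((linkBelow G v).map φ.toEquiv.toEmbedding).card = G.degree v := by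
    rw [Finset.card_map, card_linkBelow]
  have hdeg : ∀ a, G.degree v ≤ (coneGraph (Fin.last n) H ((linkBelow G v).map φ.toEquiv.toEmbedding)).degree a := by
    intro a
    have h1 := ψ.symm.degree_eq a
    exact (hv (ψ.symm a)).trans h1.le
  obtain ⟨G', hG'M, ⟨χ⟩⟩ := hExt (G.degree v) hdd' hd'D H hHL _ hS hdeg (hG.of_iso ψ)
  exact ⟨G', hG'M, ⟨ψ.trans χ⟩⟩

/-- **The extension step with nothing surviving:** if every admissible cone over the lower complete lists is not
relaxed-realisable, the graph stratum `(d, e, n + 1)` is empty. [folklore] -/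
theorem graphStratumHypothesis_succ_of_coneExtensions {n e d D : ℕ} (hD : 2 * e < (D + 1) * (n + 1))
    (L : ℕ → Set (SimpleGraph (Fin n)))
    (hL : ∀ d', d ≤ d' → d' ≤ D → CompleteListHypothesis (d' - 1) (e - d') n (L d'))
    (hExt : ∀ d', d ≤ d' → d' ≤ D → ∀ H ∈ L d', ∀ [DecidableRel H.Adj], ∀ S : Finset (Fin n), S.card = d' →
      (∀ a, d' ≤ (coneGraph (Fin.last n) H S).degree a) → ¬ RelaxedRealisable (coneGraph (Fin.last n) H S)) :
    GraphStratumHypothesis d e (n + 1) :=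
  completeListHypothesis_empty_iff.1
    (completeList_succ_of_coneExtensions hD L ∅ hL fun d' h1 h2 H hH _ S hS hdeg hR =>
      (hExt d' h1 h2 H hH S hS hdeg hR).elim)

/-! ### 5. The shapes used by the cell's certificates -/

/-- **T(12) shape (PLAN R30).** `GSH(5, 34, 12)` follows from a complete list `L` for the stratum `(4, 29, 11)` — every
relaxed-realisable 11-vertex graph with 29 edges and minimum degree `≥ 4`, up to isomorphism — together with: no cone
`coneGraph (Fin.last 11) H S`, `H ∈ L`, `|S| = 5`, with all degrees `≥ 5` is relaxed-realisable. (`2·34 = 68 < 6·12`, so a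
minimum-degree vertex of a `δ ≥ 5` graph with 34 edges on 12 vertices has degree exactly `5`.) [folklore] -/
theorem graphStratum_twelve_of_coneExtensions (L : Set (SimpleGraph (Fin 11)))
    (hL : CompleteListHypothesis 4 29 11 L)
    (hExt : ∀ H ∈ L, ∀ [DecidableRel H.Adj], ∀ S : Finset (Fin 11), S.card = 5 →
      (∀ a, 5 ≤ (coneGraph (Fin.last 11) H S).degree a) → ¬ RelaxedRealisable (coneGraph (Fin.last 11) H S)) :
    GraphStratumHypothesis 5 34 12 := by
  refine graphStratumHypothesis_succ_of_coneExtensions (n := 11) (e := 34) (d := 5) (D := 5) (by norm_num)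
    (fun _ => L) ?_ ?_
  · intro d' h1 h2
    obtain rfl : d' = 5 := le_antisymm h2 h1
    exact hL
  · intro d' h1 h2 H hH _ S hS
    obtain rfl : d' = 5 := le_antisymm h2 h1
    exact hExt H hH S hS

/-- **T(13) shape (PLAN R31/R32).** `GSH(4, 37, 13)` follows from complete lists `L₄` for `(3, 33, 12)` and `L₅` for
`(4, 32, 12)` together with: no cone over `H ∈ L₄` with `|S| = 4` and all degrees `≥ 4`, and no cone over `H ∈ L₅`
with `|S| = 5` and all degrees `≥ 5`, is relaxed-realisable. (`2·37 = 74 < 6·13`: the minimum degree is `4` or `5`.)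
[folklore] -/
theorem graphStratum_thirteen_of_coneExtensions (L₄ L₅ : Set (SimpleGraph (Fin 12)))
    (hL₄ : CompleteListHypothesis 3 33 12 L₄) (hL₅ : CompleteListHypothesis 4 32 12 L₅)
    (hExt₄ : ∀ H ∈ L₄, ∀ [DecidableRel H.Adj], ∀ S : Finset (Fin 12), S.card = 4 →
      (∀ a, 4 ≤ (coneGraph (Fin.last 12) H S).degree a) → ¬ RelaxedRealisable (coneGraph (Fin.last 12) H S))
    (hExt₅ : ∀ H ∈ L₅, ∀ [DecidableRel H.Adj], ∀ S : Finset (Fin 12), S.card = 5 →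
      (∀ a, 5 ≤ (coneGraph (Fin.last 12) H S).degree a) → ¬ RelaxedRealisable (coneGraph (Fin.last 12) H S)) :
    GraphStratumHypothesis 4 37 13 := by
  refine graphStratumHypothesis_succ_of_coneExtensions (n := 12) (e := 37) (d := 4) (D := 5) (by norm_num)
    (fun d' => if d' = 4 then L₄ else L₅) ?_ ?_
  · intro d' h1 h2
    interval_cases d'
    · simpa using hL₄
    · simpa using hL₅
  · intro d' h1 h2 H hH _ S hS
    interval_cases d'
    · exact hExt₄ H (by simpa using hH) S hS
    · exact hExt₅ H (by simpa using hH) S hS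

/-- The list `L₄` for `(3, 33, 12)` may be certified with ANY degree floor once `C(11) ≤ 29` is known: a relaxed-realisable
12-vertex graph with 33 edges has minimum degree `≥ 4` (degree floor with `c = 29`, `4 + 29 ≤ 33`). [folklore] -/
theorem completeList_twelve_33_of_floor (h11 : maxContacts 3 11 ≤ 29) {d : ℕ} (hd : d ≤ 4)
    (L : Set (SimpleGraph (Fin 12))) (hL : CompleteListHypothesis d 33 12 L) (d₀ : ℕ) :
    CompleteListHypothesis d₀ 33 12 L :=
  CompleteListHypothesis.of_degree_floor (c := 29) h11 (by omega) hL d₀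

/-- **`C(13) = 36` from certificates.** The rows `n = 8, …, 12` as graph strata (as in `GraphStratum.lean`), the two
complete lists at `n = 12` and the two cone checks give `C(13) = 36`. All hypotheses are census statements; none is
proved here. [folklore] -/
theorem maxContacts_three_thirteen_of_coneExtensions (h8 : GraphStratumHypothesis 4 19 8)
    (h9 : GraphStratumHypothesis 4 22 9) (h10 : GraphStratumHypothesis 5 26 10) (h11 : GraphStratumHypothesis 5 30 11)
    (h12 : GraphStratumHypothesis 5 34 12) (L₄ L₅ : Set (SimpleGraph (Fin 12)))
    (hL₄ : CompleteListHypothesis 3 33 12 L₄) (hL₅ : CompleteListHypothesis 4 32 12 L₅)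
    (hExt₄ : ∀ H ∈ L₄, ∀ [DecidableRel H.Adj], ∀ S : Finset (Fin 12), S.card = 4 →
      (∀ a, 4 ≤ (coneGraph (Fin.last 12) H S).degree a) → ¬ RelaxedRealisable (coneGraph (Fin.last 12) H S))
    (hExt₅ : ∀ H ∈ L₅, ∀ [DecidableRel H.Adj], ∀ S : Finset (Fin 12), S.card = 5 →
      (∀ a, 5 ≤ (coneGraph (Fin.last 12) H S).degree a) → ¬ RelaxedRealisable (coneGraph (Fin.last 12) H S)) :
    maxContacts 3 13 = 36 :=
  maxContacts_three_thirteen_of_graphStrata h8 h9 h10 h11 h12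
    (graphStratum_thirteen_of_coneExtensions L₄ L₅ hL₄ hL₅ hExt₄ hExt₅)

end Summit.Ventures.Crystal3D
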